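import Summits.QuantumFields.BalabanUV.Beta.GAN24.DirichletExhaustionCovariance

/-!
# `BalabanUV.Beta.GAN24.DirichletExhaustionCovariancePad` — binder row G-an2-4 / (CONV-C), part P2, PART 10: the END SOCKET WITH
# PADDING — when the elimination `C` has ZERO COLUMNS (Bałaban's `B = CB′`: only the FREE bonds `B′` are variables, [B6] p. 249–250),
# `CᵀΔ_kC` is coercive on the free coordinates only; padding the non-free diagonal by `1` restores (5.6) on the whole index set without
# changing `C·(·)·Cᵀ` (unit b2b-balaban-gan24-p2, gen 1, v1)

HONEST FRAMING (cell contract, verbatim): «discharging `BetaPertH` makes Bałaban's UV stability UNCONDITIONAL — a real constructive-QFT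
result; it is NOT the continuum limit and NOT the Clay problem.»  CORRECTION OF SCOPE of PART 5 (`DirichletExhaustionCovariance.convC_cov`):
its coercivity input `CovInput.hcoer` asks `γ‖v‖² ≤ ⟨v, (CᵀΔ_kC)_Λ v⟩` for ALL `v` on the ambient bond index set, which FAILS for an
elimination with zero columns (`v` supported on eliminated bonds gives `0`).  For Bałaban's `C` ([Balaban1984PropagatorsII] (2.155)–(2.157):
`C*Δ_kC` acts on the remaining variables `B′` only, where (2.157) `≥ γ′₀‖B′‖²` holds) the right socket is THIS file's: the inner operator
is PADDED, `padOp Free A (p,q) = A(p,q)` if `p, q` are both free, `= δ_{pq}` otherwise (block-diagonal `(CᵀΔ_kC)|_free ⊕ 1`), which is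
symmetric, decaying, has the SAME one-step differences, is coercive iff `(CᵀΔ_kC)|_free` is, and whose Dirichlet inverses give the same
`C·(·)·Cᵀ` because the non-free columns of `C` vanish (READING; the socket below does not need this identification).  [shape] `CovInputPad`;
END theorem `convC_covPad`.  Skeleton `HOME/b2b-balaban-gan24-p2/gen1/SKELETON-P2.md` nodes S4/S5 use THIS socket.  [folklore] composition;
nothing of Bałaban's instantiated; NOT `BetaPertH`, NOT continuum, NOT Clay.  «not in print; our proof attempt».

ABSOLUTE RULE (cell, verbatim): «No internally-minted statement may enter as a cited fact. Every hypothesis is either kernel-proved in this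
package or a verbatim quotation of a PUBLISHED theorem with page reference. The manuscript(s) under audit are NOT citable for their own disputed
steps — they are the thing under adjudication; programme-internal (2001/route/tribunal) claims are never citable.»

## What this file proves (0 sorry; imports PART 5)
`padOp`, `padOp_symm`, `padOp_abs_le`, `padOp_sub`, `opClose_padOp`; [shape] `CovInputPad Ω C Δ Free c_C c₀ δ γ θ₀ θ` (as `CovInput` but with
coercivity asked of the PADDED sandwich); `opFamilyRate_innerPad`; `covPad C Δ Free Λ k := C·(pad(CᵀΔ_kC))_Λ⁻¹·Cᵀ`; **`convC_covPad`**
(explicit constants: `c₀ ↦ max{s·c₀, 1}`).  NOT summit progress.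
-/

namespace Summit.QuantumFields.BalabanUV.Beta.GAN24.DirichletExhaustionCovariancePad

open Finset Real Filter Topology
open Literature.MathematicalPhysics.QuantumFieldTheory.Balaban1983to89
open B4Sect5Proof (cStar deltaStar cStar_pos deltaStar_pos)
open B4Sect5Exhaustion (K toMat Hyp56Z limInv)
open Summit.QuantumFields.BalabanUV.Beta.GAN24.DirichletExhaustion
open Summit.QuantumFields.BalabanUV.Beta.GAN24.DirichletExhaustionFamily
open Summit.QuantumFields.BalabanUV.Beta.GAN24.DirichletExhaustionSandwich
open Summit.QuantumFields.BalabanUV.Beta.GAN24.DirichletExhaustionCovariance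

noncomputable section

variable {d N : ℕ}

/-! ## §1 Padding an operator off a set of FREE indices -/

/-- **Padding**: `padOp Free A (p,q) = A(p,q)` if `p` and `q` are free, else `δ_{pq}` — the block-diagonal operator `A|_free ⊕ 1`. -/
def padOp (Free : K d N → Prop) [DecidablePred Free] (A : K d N → K d N → ℝ) : K d N → K d N → ℝ :=
  fun p q => if Free p ∧ Free q then A p q else if p = q then 1 else 0

section Pad

variable {Free : K d N → Prop} [DecidablePred Free] {A A' : K d N → K d N → ℝ} {c ε δ : ℝ}

/-- Padding preserves symmetry. -/
theorem padOp_symm (h : ∀ p q, A p q = A q p) (p q : K d N) : padOp Free A p q = padOp Free A q p := by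
  unfold padOp
  by_cases hp : Free p <;> by_cases hq : Free q <;> by_cases hpq : p = q <;> simp [hp, hq, hpq, h p q, eq_comm]

/-- Padding keeps an exponential entry bound, with constant `max{c, 1}` (the diagonal pad is `1 = 1·e^{−δ·0}`). -/
theorem padOp_abs_le (h : ∀ p q : K d N, |A p q| ≤ c * Real.exp (-(δ * dist p.1 q.1))) (p q : K d N) :
    |padOp Free A p q| ≤ max c 1 * Real.exp (-(δ * dist p.1 q.1)) := by
  unfold padOp
  have hc : 0 ≤ max c 1 := le_max_of_le_right zero_le_one
  split_ifs with hf hpq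
  · exact (h p q).trans (mul_le_mul_of_nonneg_right (le_max_left _ _) (Real.exp_pos _).le)
  · subst hpq
    rw [dist_self, mul_zero, neg_zero, Real.exp_zero, mul_one, abs_one]
    exact le_max_right _ _
  · rw [abs_zero]; positivity

/-- Padding cancels in differences: `pad A′ − pad A = (A′ − A)` on free pairs and `0` elsewhere. -/
theorem padOp_sub (p q : K d N) :
    padOp Free A' p q - padOp Free A p q = if Free p ∧ Free q then A' p q - A p q else 0 := by
  unfold padOp; split_ifs <;> simp

/-- Operator closeness passes through padding with the SAME `(ε, δ)` (`ε ≥ 0`). -/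
theorem opClose_padOp {Ω : Set (Fin d → ℤ)} (hε : 0 ≤ ε) (h : OpClose Ω A A' ε δ) :
    OpClose Ω (padOp Free A) (padOp Free A') ε δ := by
  intro p q hp hq
  rw [padOp_sub]
  split_ifs
  · exact h p q hp hq
  · rw [abs_zero]; positivity

end Pad

/-! ## §2 The padded socket -/

/-- [shape] **The five inputs, PADDED form**: as `DirichletExhaustionCovariance.CovInput`, except that the (2.157)-shape coercivity is asked of the
PADDED sandwich `pad(CᵀΔ_kC) = (CᵀΔ_kC)|_free ⊕ 1` (equivalently: of `CᵀΔ_kC` on vectors supported on FREE bonds, with `γ ≤ 1`).  Asserted of nothing. -/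
structure CovInputPad (Ω : Set (Fin d → ℤ)) (C : K d N → K d N → ℝ) (Δ : ℕ → K d N → K d N → ℝ) (Free : K d N → Prop)
    [DecidablePred Free] (cC c₀ δ γ θ₀ θ : ℝ) : Prop where
  hC : ∀ r p : K d N, |C r p| ≤ cC * Real.exp (-(δ * dist r.1 p.1))
  hΔ : ∀ k (r s : K d N), |Δ k r s| ≤ c₀ * Real.exp (-(δ * dist r.1 s.1))
  hΔsymm : ∀ k (r s : K d N), Δ k r s = Δ k s r
  hstep : ∀ k, OpClose (Set.univ : Set (Fin d → ℤ)) (Δ k) (Δ (k + 1)) (θ₀ * θ ^ k) δ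
  hcoer : ∀ k (Λ : Finset (Fin d → ℤ)), (↑Λ : Set (Fin d → ℤ)) ⊆ Ω →
    ∀ v : B4.Idx Λ N → ℝ, γ * ∑ p, v p ^ 2 ≤ ∑ p, v p * (toMat Λ (padOp Free (sandwich C (Δ k)))).mulVec v p

section Inner

variable {Ω : Set (Fin d → ℤ)} {C : K d N → K d N → ℝ} {Δ : ℕ → K d N → K d N → ℝ} {Free : K d N → Prop} [DecidablePred Free]
  {cC c₀ δ γ θ₀ θ : ℝ}

/-- **The padded inner family `k ↦ pad(CᵀΔ_kC)` inhabits PART 1's `OpFamilyRate`** with `(γ, max{s·c₀,1}, δ/2, s·θ₀, θ)`, `s = sandwichConst`. -/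
theorem opFamilyRate_innerPad (h : CovInputPad Ω C Δ Free cC c₀ δ γ θ₀ θ) (hδ : 0 < δ) (hcC : 0 ≤ cC) (hθ₀ : 0 ≤ θ₀) (hθ : 0 ≤ θ) :
    OpFamilyRate Ω (fun k => padOp Free (sandwich C (Δ k))) γ (max (sandwichConst d N cC δ * c₀) 1) (δ / 2)
      (sandwichConst d N cC δ * θ₀) θ where
  hyp56 k :=
    { symm := fun p q _ _ => padOp_symm (fun r s => sandwich_symm (h.hΔsymm k) r s) p q
      coercive := h.hcoer k
      decay := fun p q _ _ => padOp_abs_le (fun r s => sandwich_decay hδ hcC h.hC (h.hΔ k) r s) p q }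
  step k := by
    have hs : 0 ≤ sandwichConst d N cC δ := sandwichConst_nonneg d N cC hδ
    exact opClose_padOp (by positivity)
      (opClose_mono (opClose_sandwich_family hδ hcC h.hC h.hΔ h.hstep k) (Set.subset_univ Ω))

/-- (CONV-C) for the padded inner Dirichlet inverse family `k ↦ (pad(CᵀΔ_kC))_Λ⁻¹`, every `Λ ⊆ Ω`. -/
theorem convC_innerPad (h : CovInputPad Ω C Δ Free cC c₀ δ γ θ₀ θ) (hδ : 0 < δ) (hcC : 0 ≤ cC) (hγ : 0 < γ) (hθ₀ : 0 ≤ θ₀)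
    (hθ : 0 ≤ θ) {Λ : Set (Fin d → ℤ)} (hΛ : Λ ⊆ Ω) :
    ConvC (fun k => limInv Λ (padOp Free (sandwich C (Δ k))))
      (convConst d N γ (max (sandwichConst d N cC δ * c₀) 1) (δ / 2) (sandwichConst d N cC δ * θ₀))
      (deltaStar d N γ (max (sandwichConst d N cC δ * c₀) 1) (δ / 2)) θ := by
  have hs : 0 ≤ sandwichConst d N cC δ := sandwichConst_nonneg d N cC hδ
  exact convC_limInv hγ (lt_max_of_lt_right one_pos) (half_pos hδ) (by positivity) hθ (opFamilyRate_innerPad h hδ hcC hθ₀ hθ) hΛ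

end Inner

/-! ## §3 The padded covariance family and the END theorem -/

/-- The padded (2.156)-shaped covariance family on `Λ`: `covPad C Δ Free Λ k = C·(pad(CᵀΔ_kC))_Λ⁻¹·Cᵀ`. -/
def covPad (C : K d N → K d N → ℝ) (Δ : ℕ → K d N → K d N → ℝ) (Free : K d N → Prop) [DecidablePred Free]
    (Λ : Set (Fin d → ℤ)) (k : ℕ) : K d N → K d N → ℝ :=
  sandwich (trK C) (limInv Λ (padOp Free (sandwich C (Δ k))))

section End

variable {Ω : Set (Fin d → ℤ)} {C : K d N → K d N → ℝ} {Δ : ℕ → K d N → K d N → ℝ} {Free : K d N → Prop} [DecidablePred Free]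
  {cC c₀ δ γ θ₀ θ : ℝ}

/-- **`convC_covPad` — THE PADDED END SOCKET.**  Under `CovInputPad Ω C Δ Free c_C c₀ δ γ θ₀ θ` (`c_C ≥ 0`, `δ, γ > 0`, `θ₀, θ ≥ 0`), the
family `k ↦ C·(pad(CᵀΔ_kC))_Λ⁻¹·Cᵀ` satisfies (CONV-C) on EVERY `Λ ⊆ Ω ⊆ ℤ^d`:
`ConvC (covPad C Δ Free Λ) (s⋆·convConst d N γ c′ (δ/2) (s·θ₀)) (δ⋆/2) θ`, `c′ = max{s·c₀, 1}`, `s = sandwichConst d N c_C δ`,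
`δ⋆ = deltaStar d N γ c′ (δ/2)`, `s⋆ = sandwichConst d N c_C δ⋆` — displayed; the supplier's `θ` unchanged. -/
theorem convC_covPad (h : CovInputPad Ω C Δ Free cC c₀ δ γ θ₀ θ) (hδ : 0 < δ) (hcC : 0 ≤ cC) (hγ : 0 < γ) (hθ₀ : 0 ≤ θ₀)
    (hθ : 0 ≤ θ) {Λ : Set (Fin d → ℤ)} (hΛ : Λ ⊆ Ω) :
    ConvC (covPad C Δ Free Λ)
      (sandwichConst d N cC (deltaStar d N γ (max (sandwichConst d N cC δ * c₀) 1) (δ / 2)) *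
        convConst d N γ (max (sandwichConst d N cC δ * c₀) 1) (δ / 2) (sandwichConst d N cC δ * θ₀))
      (deltaStar d N γ (max (sandwichConst d N cC δ * c₀) 1) (δ / 2) / 2) θ := by
  have hc' : 0 < max (sandwichConst d N cC δ * c₀) 1 := lt_max_of_lt_right one_pos
  have hδs : 0 < deltaStar d N γ (max (sandwichConst d N cC δ * c₀) 1) (δ / 2) := deltaStar_pos d N hγ hc'.le (half_pos hδ)
  have hle : deltaStar d N γ (max (sandwichConst d N cC δ * c₀) 1) (δ / 2) ≤ δ :=
    (deltaStar_le d N γ _ (half_pos hδ)).trans (by linarith)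
  have hD : ∀ r p : K d N, |trK C r p| ≤
      cC * Real.exp (-(deltaStar d N γ (max (sandwichConst d N cC δ * c₀) 1) (δ / 2) * dist r.1 p.1)) :=
    bound_weaken hcC hle (trK_bound h.hC)
  exact convC_sandwich hδs hcC hD (convC_innerPad h hδ hcC hγ hθ₀ hθ hΛ)

end End

end

end Summit.QuantumFields.BalabanUV.Beta.GAN24.DirichletExhaustionCovariancePad
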